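import Literature.NumberTheory.Automorphic.BrandtMatrixThetaSeries
import Literature.NumberTheory.Automorphic.BrandtThetaSeriesClassFunction
import Literature.NumberTheory.ModularForms.SiegelThetaMultiplierGaussSum
import Literature.NumberTheory.EllipticCurves.ModularFormsGamma0Genus
import Mathlib.NumberTheory.ModularForms.CuspFormSubmodule
import HarnessLib

/-!
# Stub-ideas k=1 · GEN 6 · `stub_xiDegreeComparison` (crux `SteinbergCore`, line `p6_tamagawa_split`)

H1 (`IsCuspForm (Θ_ij − Θ_kl)`, the one residual named fact of the k2 closing chain) by RECOGNISE & IMPORT,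
gen-6 refinement of the gen-5 plan: the analytic spine E1/E1′/E2/G1/L1 is kept; the arithmetic input E4
("Gram matrices congruent modulo every `2d`", which hides local unit-norm surjectivity at EVERY prime incl. the
ramified ones) is REPLACED by a GLOBAL SUBLATTICE TRANSFER inside `S.D` (Gunning §22 "corollary to the corollary" /
Cox 2.25 representative change, quaternary version):

* B1 a right ideal `I` contains `β` with `nrd β / q_I` prime to any given `c` (primitivity, `nrdIdeal I = ℤ q_I`);
* B2 unit residues are reduced norms of `O` modulo `p^e` at every SPLIT prime `p ∤ N⁻` (tree: Eichler local model
     `IsEichlerOrder.exists_conjUnit_localAt_iff_eichler` + density `AlgHom.exists_norm_sub_le`);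
* B3 CRT for reduced norms inside the order `O ≅ ℤ⁴`;
* B4 `y ∈ (I : I')_L ⇒ (q'/q)·ȳ ∈ (I' : I)_L` (tree: `(I : I')_L = q'⁻¹ I Ī'`, `latticeConj_mul`);
* B5 (assembly of B1–B4 + basis bookkeeping) for same-row classes `(i,j), (i,l)` and every `c ≥ 1` an integer
     `n ⊥ c`, `n ≡ 1 (mod (c, N/(N,c)))`, and `U, V ∈ M₄(ℤ)` with `ᵗU [T_ij] U = n [T_il]`, `UV = n·1`;
* C1 `γ' = δ γ T^h` with `δ ∈ Γ₀(N)` whenever `γ, γ'` share `c ≠ 0`, `a' ≡ n a (mod c)`, `n ≡ 1 (mod (c, N/(N,c)))`;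
* C2 `v(f ∣ δγT^h) = v(f ∣ γ)`;  C3 `G(a/c, nQ) = G(na/c, Q)`, `G(a/c,Q)` depends on `a mod c`;
* C4 (assembly of B5+E2+C3+C1) `thetaCuspValue [T_ij] γ = thetaCuspValue [T_il] γ'` for such a `γ'`.

Composition `brandtTheta_sub_isCuspForm_sameRow` and (with `brandtTheta_symm`, k3's N2) `brandtTheta_sub_isCuspForm`
are kernel-checked modulo the sorried helpers. Evidence / plan only.
-/

noncomputable section

open Complex hiding I
open Matrix Filter Topology ModularForm
open UpperHalfPlane hiding I
open Complex (I)
open scoped MatrixGroups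

namespace Summit.ABC.ABC.Cruxes.SteinbergCore.StubIdeasK1G6

open Literature.NumberTheory.ModularForms
open Literature.NumberTheory.ModularForms.SiegelModularForm (one1)
open Literature.NumberTheory.EllipticCurves.ModularForms
open Literature.NumberTheory.Automorphic Literature.NumberTheory.Automorphic.Brandt

/-! ## §0 Dictionary (as in gen 5) -/

variable {Nplus Nminus : ℕ} (S : XiSetup Nplus Nminus)

/-- The Gram matrix `[T_{ij}]` behind `S.brandtTheta i j` (basis of `(I_j : I_i)_L = transporterLeft I_i I_j`, `q = q_j/q_i`). -/
def brandtGram (i j : ClassSet S.O) : Matrix (Fin 4) (Fin 4) ℤ :=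
  normFormGram (S.nonempty_basis_transporterLeft i.rep_mem j.rep_mem).some (S.nrdGen j.rep_mem / S.nrdGen i.rep_mem)

theorem brandtTheta_apply (i j : ClassSet S.O) (τ : ℍ) :
    S.brandtTheta i j τ = siegelThetaSeries (brandtGram S i j) (one1 (τ : ℂ)) := rfl

theorem det_brandtGram (i j : ClassSet S.O) : (brandtGram S i j).det = ((Nplus * Nminus : ℕ) : ℤ) ^ 2 :=
  (S.ofLeftOrder i.rep_mem).det_normFormGram (S.transporterLeft_mem_rightIdeals_leftOrder i.rep_mem j.rep_mem)
    (div_pos (S.nrdGen_pos j.rep_mem) (S.nrdGen_pos i.rep_mem))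
    (S.nrdIdeal_transporterLeft j.rep_mem i.rep_mem (S.nrdGen_pos j.rep_mem) (S.nrdGen_pos i.rep_mem)
      (S.nrdIdeal_eq_span_nrdGen j.rep_mem) (S.nrdIdeal_eq_span_nrdGen i.rep_mem))
    ((S.ofLeftOrder i.rep_mem).cast_normFormGram_mul (div_pos (S.nrdGen_pos j.rep_mem) (S.nrdGen_pos i.rep_mem)).ne'
      (S.nrdIdeal_transporterLeft j.rep_mem i.rep_mem (S.nrdGen_pos j.rep_mem) (S.nrdGen_pos i.rep_mem)
        (S.nrdIdeal_eq_span_nrdGen j.rep_mem) (S.nrdIdeal_eq_span_nrdGen i.rep_mem)) _)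

/-- Cusp constant of `θ_Q ∣ γ` (gen 5): `d^{m/2}` at `c = 0`, else `(√det Q)⁻¹ (ic)^{−m/2} |c|^m G(a/c, Q)`. -/
def thetaCuspValue {m : ℕ} (Q : Matrix (Fin m) (Fin m) ℤ) (γ : SL(2, ℤ)) : ℂ :=
  if γ 1 0 = 0 then ((γ 1 1 : ℤ) : ℂ) ^ (m / 2)
  else ((Real.sqrt ((Q.det : ℤ) : ℝ) : ℝ) : ℂ)⁻¹ * (I * ((γ 1 0 : ℤ) : ℂ)) ^ (-((m / 2 : ℕ) : ℤ)) *
      (((γ 1 0).natAbs : ℕ) : ℂ) ^ m *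
        siegelGaussSum Q (γ 1 0).natAbs (one1 (((γ 0 0 : ℤ) : ℂ) / ((γ 1 0 : ℤ) : ℂ)))

/-! ## §A Analytic spine (gen 5, unchanged): E1′, E2 open; G1, L1 proved -/

/-- **E1′ (gen 5, size S after E1 (M)).** `v(Θ_ij ∣_2 γ) = thetaCuspValue [T_{ij}] γ`. -/
theorem valueAtInfty_slash_brandtTheta [NeZero (Nplus * Nminus)] (i j : ClassSet S.O) (γ : SL(2, ℤ)) :
    valueAtInfty (⇑(S.brandtTheta i j) ∣[(2 : ℤ)] (γ : GL (Fin 2) ℝ)) = thetaCuspValue (brandtGram S i j) γ := by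
  sorry

/-- **E2 (gen 5, size S/M, finite sums).** Gauss sums only see `Q` modulo congruence-equivalence mod `2d`. -/
theorem siegelGaussSum_congr_mod {m : ℕ} {Q Q' U V : Matrix (Fin m) (Fin m) ℤ} (hQ : Q.IsSymm) (hQe : ∀ i, Even (Q i i))
    (hQ' : Q'.IsSymm) (hQ'e : ∀ i, Even (Q' i i)) {d : ℕ} (hd : 0 < d)
    (hUV : ∀ r s, (d : ℤ) ∣ (U * V - 1) r s) (hcong : ∀ r s, 2 * (d : ℤ) ∣ (Q' - Uᵀ * Q * U) r s)
    (a : ℤ) {c : ℤ} (hcd : c.natAbs = d) :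
    siegelGaussSum Q' d (one1 ((a : ℂ) / (c : ℂ))) = siegelGaussSum Q d (one1 ((a : ℂ) / (c : ℂ))) := by
  sorry

/-- **L1 (gen 5, PROVED there verbatim; repeated).** Equal values of all `SL₂(ℤ)`-translates ⇒ the difference is cuspidal. -/
theorem isCuspForm_sub_of_forall_valueAtInfty_slash_eq {N : ℕ} [NeZero N] (f g : ModularForm (CongruenceSubgroup.Gamma0 N) 2)
    (h : ∀ γ : SL(2, ℤ), valueAtInfty (⇑f ∣[(2 : ℤ)] (γ : GL (Fin 2) ℝ)) = valueAtInfty (⇑g ∣[(2 : ℤ)] (γ : GL (Fin 2) ℝ))) :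
    ModularForm.IsCuspForm (f - g) := by
  have hF : (⇑f - ⇑g) ∈ gamma0Space N 2 := Submodule.sub_mem _ (coe_mem_formSpace f) (coe_mem_formSpace g)
  have hlim : ∀ (u : ModularForm (CongruenceSubgroup.Gamma0 N) 2) (γ : SL(2, ℤ)),
      Tendsto (⇑u ∣[(2 : ℤ)] (γ : GL (Fin 2) ℝ)) atImInfty (𝓝 (valueAtInfty (⇑u ∣[(2 : ℤ)] (γ : GL (Fin 2) ℝ)))) := by
    intro u γ
    have := tendsto_cosetSlash (coe_mem_formSpace u) ((γ⁻¹ : SL(2, ℤ)) : SL(2, ℤ) ⧸ CongruenceSubgroup.Gamma0 N)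
    rwa [cosetSlash_mk (slash_eq_of_mem_gamma0Space (coe_mem_formSpace u)), inv_inv] at this
  have h0 : ∀ γ : SL(2, ℤ), IsZeroAtImInfty ((⇑f - ⇑g) ∣[(2 : ℤ)] (γ : GL (Fin 2) ℝ)) := by
    intro γ
    have hsub : (⇑f - ⇑g) ∣[(2 : ℤ)] (γ : GL (Fin 2) ℝ) =
        ⇑f ∣[(2 : ℤ)] (γ : GL (Fin 2) ℝ) - ⇑g ∣[(2 : ℤ)] (γ : GL (Fin 2) ℝ) := by
      rw [sub_eq_add_neg, SlashAction.add_slash, SlashAction.neg_slash, ← sub_eq_add_neg]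
    show Tendsto ((⇑f - ⇑g) ∣[(2 : ℤ)] (γ : GL (Fin 2) ℝ)) atImInfty (𝓝 0)
    rw [hsub]
    have := (hlim f γ).sub (hlim g γ)
    rwa [h γ, sub_self] at this
  refine ⟨cuspFormOfVanishing (⇑f - ⇑g) hF h0, ?_⟩
  ext τ
  rw [CuspForm.toModularFormₗ_apply, ModularForm.sub_apply]
  rfl

/-! ## §B Arithmetic block (NEW, replaces gen-5 E4): the global sublattice transfer -/

/-- **B0 (size S; only to make H1 hypothesis-free — for Frey levels `hcop` also follows from
`conductorNorm_freyCurve_dvd_holds`, odd `p ∣ N ⇒ p ∥ N`).** The level of an Eichler order is prime to the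
discriminant: at `p ∣ N⁻` both maximal orders localise to THE maximal order
(`IsEichlerOrder.exists_isMaximalZOrder_localAt_eq_of_padic_division`, `IsMaximalZOrder.localAt_eq_of_padic_division`),
so the local index is `1` and `p ∤ [O₁ : O] = N⁺` (`relIndex_localAt`). -/
theorem coprime_level_disc (S : XiSetup Nplus Nminus) (hN : Nplus ≠ 0) : Nplus.Coprime Nminus := by
  sorry

/-- **B1 (size S).** A right `O`-ideal `I` (`nrdIdeal I = ℤ q_I`) contains `β` with `nrd β = m q_I`, `m` prime to `c`:
for each `p ∣ c` some `b_p ∈ I` has `p ∤ nrd(b_p)/q_I` (else `nrdIdeal I ⊆ p q_I ℤ`), glue `β ≡ b_p (mod p I)` by CRT in the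
lattice `I` (`nrd(b + p w)/q = nrd(b)/q + p(trd(b w̄)/q + p nrd(w)/q)`, all brackets integral). -/
theorem exists_mem_reducedNorm_eq_mul_coprime {I : Submodule ℤ S.D} (hI : I ∈ rightIdeals S.O) {c : ℕ} (hc : 0 < c) :
    ∃ β ∈ I, ∃ m : ℕ, reducedNorm ℚ S.D β = m * S.nrdGen hI ∧ m.Coprime c := by
  sorry

/-- **B2 (size M) — unit residues are norms at a split prime.** For `p ∤ N⁻` (so `D_p ≅ M₂(ℚ_p)`: `S.ramifiedPlaces_eq`,
`ramifiedPlaces = {v | ¬ IsSplitAt D v}`), every `t ⊥ p` is `nrd z (mod p^e)` for some `z ∈ O`: with the Eichler model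
`IsEichlerOrder.exists_conjUnit_localAt_iff_eichler` pick `z₀ ∈ D` with `u⁻¹φ(z₀)u` within `p^{-(e+n)}` of `diag(t,1)`
(`AlgHom.exists_norm_sub_le`), so `z₀ ∈ O_(p)` (`Padic.integral_of_norm_sub_le`) and `|det φ z₀ − t|_p ≤ p^{-e}`; then
`z = s's·z₀ ∈ O` with `s z₀ ∈ O`, `p ∤ s`, `s s' ≡ 1 (mod p^e)`. -/
theorem exists_mem_order_reducedNorm_modEq_of_not_dvd {p : ℕ} [Fact p.Prime] (hp : ¬ p ∣ Nminus) (hN : 0 < Nplus)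
    (e : ℕ) {t : ℤ} (ht : IsCoprime t p) :
    ∃ z ∈ S.O, ∃ nz : ℤ, reducedNorm ℚ S.D z = nz ∧ (p : ℤ) ^ e ∣ nz - t := by
  sorry

/-- **B3 (size S) — CRT for reduced norms in `O`.** Local targets `z_p ∈ O` (`p ∣ M`) are met simultaneously modulo
`p^{v_p M}` by one `w ∈ O` (`O ≅ ℤ⁴`, coordinatewise CRT; `nrd(z + p^e y) ≡ nrd z (mod p^e)` inside an order). -/
theorem exists_mem_order_reducedNorm_modEq_forall {M : ℕ} (hM : 0 < M) (z : ℕ → S.D) (hz : ∀ p ∈ M.primeFactors, z p ∈ S.O) :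
    ∃ w ∈ S.O, ∃ nw : ℤ, reducedNorm ℚ S.D w = nw ∧
      ∀ p ∈ M.primeFactors, ∃ np : ℤ, reducedNorm ℚ S.D (z p) = np ∧ (p : ℤ) ^ M.factorization p ∣ nw - np := by
  sorry

/-- **B4 (size S) — the involution swaps Eichler's lattices.** `y ∈ (I : I')_L = q'⁻¹ I Ī'` ⇒ `ȳ ∈ q'⁻¹ I' Ī = (q/q')(I' : I)_L`
(tree: `exists_transporterLeft_eq_units_inv_smul_mul_latticeConj` twice, `latticeConj_mul`, `latticeConj_latticeConj`). -/
theorem smul_standardInvolution_mem_transporterLeft {I I' : Submodule ℤ S.D} (hI : I ∈ rightIdeals S.O)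
    (hI' : I' ∈ rightIdeals S.O) {y : S.D} (hy : y ∈ transporterLeft I' I) :
    algebraMap ℚ S.D (S.nrdGen hI' / S.nrdGen hI) * standardInvolution ℚ S.D y ∈ transporterLeft I I' := by
  sorry

/-- **B4′ (XS, proved).** Transporters compose: `y I' ⊆ I`, `w I'' ⊆ I'` ⇒ `(y w) I'' ⊆ I`. -/
theorem mul_mem_transporterLeft {I I' I'' : Submodule ℤ S.D} {y w : S.D} (hy : y ∈ transporterLeft I' I)
    (hw : w ∈ transporterLeft I'' I') : y * w ∈ transporterLeft I'' I := by
  rw [mem_transporterLeft_iff] at hy hw ⊢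
  intro m hm
  rw [mul_assoc]
  exact hy _ (hw m hm)

/-- **B5 (size M, assembly of B1–B4 + basis bookkeeping) — THE arithmetic input.** For same-row classes and every
`c ≥ 1`: `y = β_j z β̄_l / q_l ∈ (I_j : I_l)_L` (B1 for `β_j, β_l`, B2+B3 for `z`) has `Q_{lj}(y) = m_j m_l nrd z =: n`,
`n ⊥ c`, `n ≡ 1 (mod (c, N/(N,c)))` (the modulus is supported on primes `p² ∣ N⁺`, all split); `y·(I_l : I_i)_L ⊆ (I_j : I_i)_L`
(B4′), `n (I_j : I_i)_L ⊆ y (I_l : I_i)_L` (B4: `y · (q_l/q_j)ȳ = n`), and `Q_{ij}(y w) = n Q_{il}(w)`; `U` = matrix of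
`w ↦ y w` in the defining bases, `V` = matrix of `n·` back. -/
theorem exists_brandtGram_sublattice_datum (hN : 0 < Nplus) (hcop : Nplus.Coprime Nminus) (i j l : ClassSet S.O)
    {c : ℕ} (hc : 0 < c) :
    ∃ n : ℕ, n.Coprime c ∧ n ≡ 1 [MOD Nat.gcd c ((Nplus * Nminus) / Nat.gcd (Nplus * Nminus) c)] ∧
      ∃ U V : Matrix (Fin 4) (Fin 4) ℤ,
        Uᵀ * brandtGram S i j * U = (n : ℤ) • brandtGram S i l ∧ U * V = (n : ℤ) • (1 : Matrix (Fin 4) (Fin 4) ℤ) := by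
  sorry

/-! ## §C Modular glue (NEW): cusp equivalence replaces unit-norm surjectivity at odd primes -/

/-- **C1 (size S, `SL₂(ℤ)` algebra; Gunning §22 "corollary to the corollary" in `Γ₀(N)` form).** If `γ = (a b; c d)`,
`γ' = (a' b'; c d')` share `c ≠ 0`, `a' ≡ n a (mod c)` and `n ≡ 1 (mod (c, N/(N,c)))`, then `γ' ∈ Γ₀(N) γ T^ℤ`:
`δ_h := γ' T^{-h} γ⁻¹` has lower-left entry `c(d − d' + ch)`, and `N ∣ c·x ⇔ N/(N,c) ∣ x` is solvable in `h` iff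
`(c, N/(N,c)) ∣ d' − d ≡ a⁻¹(n⁻¹ − 1)`. -/
theorem exists_gamma0_mul_T_zpow {N : ℕ} (γ γ' : SL(2, ℤ)) (hc : γ 1 0 ≠ 0) (hcc : γ' 1 0 = γ 1 0) {n : ℤ}
    (hn : (γ 1 0 : ℤ) ∣ γ' 0 0 - n * γ 0 0)
    (hg : ((Nat.gcd (γ 1 0).natAbs (N / Nat.gcd N (γ 1 0).natAbs) : ℕ) : ℤ) ∣ n - 1) :
    ∃ δ ∈ CongruenceSubgroup.Gamma0 N, ∃ h : ℤ, γ' = δ * γ * ModularGroup.T ^ h := by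
  sorry

/-- **C2 (size S, tree glue).** `v(f ∣ δ γ T^h) = v(f ∣ γ)` for `δ ∈ Γ₀(N)` (`slash_eq_of_mem_gamma0Space`,
`slash_T_zpow_eq_transl`, `tendsto_T_zpow_smul_atImInfty`, `tendsto_cosetSlash`). -/
theorem valueAtInfty_slash_gamma0_mul_T_zpow {N : ℕ} [NeZero N] {k : ℤ} (f : ModularForm (CongruenceSubgroup.Gamma0 N) k)
    (γ : SL(2, ℤ)) {δ : SL(2, ℤ)} (hδ : δ ∈ CongruenceSubgroup.Gamma0 N) (h : ℤ) :
    valueAtInfty (⇑f ∣[k] ((δ * γ * ModularGroup.T ^ h : SL(2, ℤ)) : GL (Fin 2) ℝ)) =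
      valueAtInfty (⇑f ∣[k] (γ : GL (Fin 2) ℝ)) := by
  have hγ : ⇑f ∣[k] ((δ * γ * ModularGroup.T ^ h : SL(2, ℤ)) : GL (Fin 2) ℝ) =
      transl h (⇑f ∣[k] (γ : GL (Fin 2) ℝ)) := by
    rw [coeGL_mul, coeGL_mul, SlashAction.slash_mul, SlashAction.slash_mul,
      slash_eq_of_mem_gamma0Space (coe_mem_formSpace f) δ hδ, slash_T_zpow_eq_transl]
  have hlim : Tendsto (⇑f ∣[k] (γ : GL (Fin 2) ℝ)) atImInfty (𝓝 (valueAtInfty (⇑f ∣[k] (γ : GL (Fin 2) ℝ)))) := by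
    have := tendsto_cosetSlash (coe_mem_formSpace f) ((γ⁻¹ : SL(2, ℤ)) : SL(2, ℤ) ⧸ CongruenceSubgroup.Gamma0 N)
    rwa [cosetSlash_mk (slash_eq_of_mem_gamma0Space (coe_mem_formSpace f)), inv_inv] at this
  rw [hγ]
  exact (hlim.comp (tendsto_T_zpow_smul_atImInfty h)).limUnder_eq

/-- **C3a (size XS).** `G(S, nQ) = G(nS, Q)` (`Q[L]·(nS) = (nQ)[L]·S` under the trace). -/
theorem siegelGaussSum_natCast_smul {m k : ℕ} (Q : Matrix (Fin m) (Fin m) ℤ) (n d : ℕ) (T : Matrix (Fin k) (Fin k) ℂ) :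
    siegelGaussSum ((n : ℤ) • Q) d T = siegelGaussSum Q d ((n : ℂ) • T) := by
  simp only [siegelGaussSum]
  refine congrArg₂ (· * ·) rfl (Finset.sum_congr rfl fun L _ => ?_)
  rw [siegelThetaSeriesTerm_def, siegelThetaSeriesTerm_def]
  have hmap : ((n : ℤ) • Q).map ((↑) : ℤ → ℂ) = (n : ℂ) • Q.map ((↑) : ℤ → ℂ) := by
    ext i j; simp only [Matrix.map_apply, Matrix.smul_apply, smul_eq_mul, Int.cast_mul, Int.cast_natCast]
  simp only [hmap, Matrix.mul_smul, Matrix.smul_mul]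

/-- **C3b (size S).** `G(a/c, Q)` depends only on `a mod c` for even `Q` (`Q[L] ∈ 2ℤ`, `e^{πi Q[L] k} = 1`). -/
theorem siegelGaussSum_congr_num {m : ℕ} {Q : Matrix (Fin m) (Fin m) ℤ} (hQ : Q.IsSymm) (hQe : ∀ i, Even (Q i i))
    {a a' c : ℤ} (hc : c ≠ 0) (h : a ≡ a' [ZMOD c]) :
    siegelGaussSum Q c.natAbs (one1 ((a : ℂ) / (c : ℂ))) = siegelGaussSum Q c.natAbs (one1 ((a' : ℂ) / (c : ℂ))) := by
  sorry

/-- **C4 (size S, assembly of B5 + E2 + C3 + C1 + `det_brandtGram`).** For same-row classes and any `γ` there is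
`γ' ∈ Γ₀(N⁺N⁻) γ T^ℤ` with `thetaCuspValue [T_ij] γ = thetaCuspValue [T_il] γ'` (`c = 0`: `γ' = γ`; `c ≠ 0`: `n, U, V` from B5
at `|c|`, `V' = n̄ V`, E2 gives `G(a/c,[T_ij]) = G(a/c, n[T_il]) = G(na/c,[T_il])` (C3a) `= G(a'/c,[T_il])` (C3b) with `γ'` from C1). -/
theorem exists_thetaCuspValue_brandtGram_eq_sameRow [NeZero (Nplus * Nminus)] (hcop : Nplus.Coprime Nminus)
    (i j l : ClassSet S.O) (γ : SL(2, ℤ)) :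
    ∃ γ' : SL(2, ℤ), (∃ δ ∈ CongruenceSubgroup.Gamma0 (Nplus * Nminus), ∃ h : ℤ, γ' = δ * γ * ModularGroup.T ^ h) ∧
      thetaCuspValue (brandtGram S i j) γ = thetaCuspValue (brandtGram S i l) γ' := by
  sorry

/-! ## §D Composition (kernel-checked modulo the helpers) -/

/-- **H1, same row.** `Θ_ij − Θ_il ∈ S_2(Γ_0(N⁺N⁻))` — from E1′ (both sides), C4, C2 and L1. -/
theorem brandtTheta_sub_isCuspForm_sameRow [NeZero (Nplus * Nminus)] (hcop : Nplus.Coprime Nminus)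
    (i j l : ClassSet S.O) : ModularForm.IsCuspForm (S.brandtTheta i j - S.brandtTheta i l) := by
  refine isCuspForm_sub_of_forall_valueAtInfty_slash_eq _ _ fun γ => ?_
  obtain ⟨γ', ⟨δ, hδ, h, rfl⟩, hv⟩ := exists_thetaCuspValue_brandtGram_eq_sameRow S hcop i j l γ
  rw [valueAtInfty_slash_brandtTheta S i j γ, hv, ← valueAtInfty_slash_brandtTheta S i l,
    valueAtInfty_slash_gamma0_mul_T_zpow (S.brandtTheta i l) γ hδ h]

/-- **H1, all pairs** (k3 N2: same-row suffices, by `XiSetup.brandtTheta_symm` and additivity of the cusp submodule). -/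
theorem brandtTheta_sub_isCuspForm_of_coprime [NeZero (Nplus * Nminus)] (hcop : Nplus.Coprime Nminus)
    (i j k l : ClassSet S.O) : ModularForm.IsCuspForm (S.brandtTheta i j - S.brandtTheta k l) := by
  have h1 := brandtTheta_sub_isCuspForm_sameRow S hcop i j l
  have h2 := brandtTheta_sub_isCuspForm_sameRow S hcop l i k
  rw [S.brandtTheta_symm l i, S.brandtTheta_symm l k] at h2
  have h3 : S.brandtTheta i j - S.brandtTheta k l = (S.brandtTheta i j - S.brandtTheta i l) + (S.brandtTheta i l - S.brandtTheta k l) := by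
    abel
  rw [ModularForm.IsCuspForm, h3]
  exact Submodule.add_mem _ h1 h2

/-- **H1** exactly as consumed by k2's closing chain (`hcop` discharged by B0). -/
theorem brandtTheta_sub_isCuspForm [NeZero (Nplus * Nminus)] (i j k l : ClassSet S.O) :
    ModularForm.IsCuspForm (S.brandtTheta i j - S.brandtTheta k l) :=
  brandtTheta_sub_isCuspForm_of_coprime S
    (coprime_level_disc S (mul_ne_zero_iff.mp (NeZero.ne (Nplus * Nminus))).1) i j k l

end Summit.ABC.ABC.Cruxes.SteinbergCore.StubIdeasK1G6
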